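import Literature.MathematicalPhysics.QuantumFieldTheory.Balaban1983to89.BlockAveragingEMLLinearised

/-!
# BalabanUVNodes ∕ node N18 = NE5 — closure-ledger item (iii), (β2) first brick: LIPSCHITZ CONTROL OF PRODUCTS OF NEAR-IDENTITY FACTORS AND OF `SU(N)`
# HOLONOMIES TO FIRST ORDER — the difference of the second-order remainders `U(Γ) − 1 − Y(Γ)` of two configurations is bounded by `O(|Γ|²·δ)` times the
# distance of the configurations (Track A, DAG node N18 = `T4OutputRate.NE5` :211; cluster K4 «SpineRates», item K3⁷ `SpineGivenEndpointR13SepCoPH`; module 22 of seat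
# pub-ymgap-dag-n18-d, strategy s2)

HONEST FRAMING.  Count-neutral kernel bookkeeping (`--supports stmt-QuantumFields-20544 --as helper`); elementary normed-ring estimates, PROVED.  NE5 is NOT
PRINTED and NOT proved; N18 is NOT discharged; this is the first brick of the C¹ remainder (β2) of `N18-BETA-SPEC.md`, not the remainder itself.

WHY.  The (1.12) half of the transport clause ((T3) of module 21, see `N18-BETA-SPEC.md` in the seat's HOME) needs the `|∇^ξA|`-letter of the transported potential,
i.e. control of COARSE DIFFERENCES of the averaged field.  At first order this is King's K-row (module 19a, exact); the second-order remainder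
`R_c(U) = Ū(c) − 1 − (Q₁Y)(c)` of [Balaban1985Averaging] Prop 3 (123) has only a SUP bound in the tree (`BlockAveragingEMLLinearised.norm_avgFun_sub_one_sub_linAvg_le`,
`81(ℓδ)²`), whereas a coarse difference `R_{c+e_ν}(U) − R_c(U) = R_c(U′) − R_c(U)` (`U′` = the translate of `U`, `BlockAveraging.avgFun_translate`) needs a LIPSCHITZ bound
in the configuration — print's «`C(V₀, A)` is an analytic function of `A` whose Taylor expansion begins with a second-order polynomial» (Prop 3 p.36).  The C⁰ proof
is a chain (products of step factors → holonomies to first order → loop variables → the `exp[mean log]` correction); this file types the Lipschitz twins of its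
first two links: §1 for products of factors of norm `≤ 1` within `δ` of `1` in any normed ring with `‖1‖ = 1`, §2 for the `SU(N)` holonomies `T4Continuum.holAt`
and their first-order remainders `holAt U Γ − 1 − walkSum (U − 1) Γ` (`BlockAveragingEMLLinearised.walkSum`, `stepFactor`, `coe_holAt_eq_prod_stepFactor`).

WHAT.
* §1 `norm_prod_map_le_one`, `norm_prod_map_sub_one_le` (`‖Πf − 1‖ ≤ |Γ|·δ`), ★ `norm_prod_map_sub_prod_map_le` (`‖Πf − Πg‖ ≤ Σ‖f − g‖`),
  ★ `norm_prodRem_sub_prodRem_le` (`‖(Πf − 1 − Σ(f−1)) − (Πg − 1 − Σ(g−1))‖ ≤ |Γ|²·δ·ε`).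
* §2 `norm_stepFactor_sub_stepFactor_eq`, `norm_stepFactor_sub_one_le`, ★ `norm_holAt_sub_holAt_le` (`‖U(Γ) − U′(Γ)‖ ≤ Σ_{s∈Γ} ‖U_{b(s)} − U′_{b(s)}‖`),
  `norm_starRem_sub_starRem_le` (the backward-step second-order term `U⁻¹ − 1 + (U − 1) = U⁻¹(U−1)²` is `3δ`-Lipschitz), `norm_signedRem_sub_signedRem_le`,
  `norm_sumRem_sub_sumRem_le`,
  ★ `norm_holAtRem_sub_holAtRem_le` (`‖(U(Γ) − 1 − Y(Γ)) − (U′(Γ) − 1 − Y′(Γ))‖ ≤ (|Γ|² + 3|Γ|)·δ·ε`).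
Next links (not here): the loop variables of (0.4) and the `exp[mean log]` correction (`BlockAveragingEMLAnalyticMean.norm_fderiv_eml_sub_mean_le` + mean value), then
the assembly `‖R_c(U) − R_c(U′)‖ ≤ C·ℓ²·δ·sup‖U − U′‖` and its use with `avgFun_translate` (spec §(β2)).

WHAT THIS IS NOT.  Not the C¹ remainder; not (β); finite tori — not continuum ∕ OS ∕ mass gap ∕ Clay.  0 `def`, 0 `sorry`, standard axioms.
-/

open scoped BigOperators

namespace YMDAG.N18.HolonomyLipschitz

open Literature.MathematicalPhysics.QuantumFieldTheory.Balaban1983to89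
open Literature.MathematicalPhysics.QuantumFieldTheory.Balaban1983to89.T4Continuum
open Literature.MathematicalPhysics.QuantumFieldTheory.Balaban1983to89.BlockAveragingEMLLinearised (walkSum walkSum_cons stepFactor coe_holAt_eq_prod_stepFactor)

/-! ## §1 Products of factors of norm `≤ 1` within `δ` of `1`: Lipschitz control to first order -/

section Products

variable {α R : Type*} [NormedRing R] [NormOneClass R]

/-- A product of factors of norm `≤ 1` has norm `≤ 1`. [folklore] -/
theorem norm_prod_map_le_one (f : α → R) : ∀ (γ : List α), (∀ a ∈ γ, ‖f a‖ ≤ 1) → ‖(γ.map f).prod‖ ≤ 1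
  | [], _ => by simp
  | a :: γ, h => by
    rw [List.map_cons, List.prod_cons]
    have ha := h a (by simp)
    have ih := norm_prod_map_le_one f γ fun b hb => h b (List.mem_cons_of_mem a hb)
    calc ‖f a * (γ.map f).prod‖ ≤ ‖f a‖ * ‖(γ.map f).prod‖ := norm_mul_le _ _
      _ ≤ 1 * 1 := mul_le_mul ha ih (norm_nonneg _) zero_le_one
      _ = 1 := one_mul 1

/-- **ZEROTH ORDER**: `‖Πf − 1‖ ≤ |Γ|·δ` for factors of norm `≤ 1` within `δ` of `1` (`f·P − 1 = (f − 1)·P + (P − 1)`). [cite: Balaban1985Averaging, (122)-(123) p.36] -/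
theorem norm_prod_map_sub_one_le (f : α → R) {δ : ℝ} :
    ∀ (γ : List α), (∀ a ∈ γ, ‖f a‖ ≤ 1) → (∀ a ∈ γ, ‖f a - 1‖ ≤ δ) → ‖(γ.map f).prod - 1‖ ≤ γ.length * δ
  | [], _, _ => by simp
  | a :: γ, h1, hδ => by
    rw [List.map_cons, List.prod_cons, List.length_cons]
    have ih := norm_prod_map_sub_one_le f γ (fun b hb => h1 b (List.mem_cons_of_mem a hb)) fun b hb => hδ b (List.mem_cons_of_mem a hb)
    have hP := norm_prod_map_le_one f γ fun b hb => h1 b (List.mem_cons_of_mem a hb)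
    have e : f a * (γ.map f).prod - 1 = (f a - 1) * (γ.map f).prod + ((γ.map f).prod - 1) := by noncomm_ring
    rw [e]
    calc ‖(f a - 1) * (γ.map f).prod + ((γ.map f).prod - 1)‖ ≤ ‖f a - 1‖ * ‖(γ.map f).prod‖ + ‖(γ.map f).prod - 1‖ :=
          (norm_add_le _ _).trans (add_le_add (norm_mul_le _ _) le_rfl)
      _ ≤ δ * 1 + γ.length * δ := add_le_add (mul_le_mul (hδ a (by simp)) hP (norm_nonneg _) ((norm_nonneg _).trans (hδ a (by simp)))) ih
      _ = ((γ.length + 1 : ℕ) : ℝ) * δ := by push_cast; ring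

/-- ★ **PRODUCTS ARE `1`-LIPSCHITZ IN EACH FACTOR**: `‖Πf − Πg‖ ≤ Σ_{a∈Γ} ‖f a − g a‖` for factors of norm `≤ 1` (`fP − gQ = (f − g)P + g(P − Q)`).
[cite: Balaban1985Averaging, Prop. 3 p.36 («C(V₀, A) is an analytic function of A»)] -/
theorem norm_prod_map_sub_prod_map_le (f g : α → R) :
    ∀ (γ : List α), (∀ a ∈ γ, ‖f a‖ ≤ 1) → (∀ a ∈ γ, ‖g a‖ ≤ 1) → ‖(γ.map f).prod - (γ.map g).prod‖ ≤ (γ.map fun a => ‖f a - g a‖).sum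
  | [], _, _ => by simp
  | a :: γ, hf, hg => by
    rw [List.map_cons, List.map_cons, List.prod_cons, List.prod_cons, List.map_cons, List.sum_cons]
    have ih := norm_prod_map_sub_prod_map_le f g γ (fun b hb => hf b (List.mem_cons_of_mem a hb)) fun b hb => hg b (List.mem_cons_of_mem a hb)
    have hP := norm_prod_map_le_one f γ fun b hb => hf b (List.mem_cons_of_mem a hb)
    have e : f a * (γ.map f).prod - g a * (γ.map g).prod = (f a - g a) * (γ.map f).prod + g a * ((γ.map f).prod - (γ.map g).prod) := by
      noncomm_ring
    rw [e]
    calc ‖(f a - g a) * (γ.map f).prod + g a * ((γ.map f).prod - (γ.map g).prod)‖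
        ≤ ‖f a - g a‖ * ‖(γ.map f).prod‖ + ‖g a‖ * ‖(γ.map f).prod - (γ.map g).prod‖ :=
          (norm_add_le _ _).trans (add_le_add (norm_mul_le _ _) (norm_mul_le _ _))
      _ ≤ ‖f a - g a‖ * 1 + 1 * (γ.map fun a => ‖f a - g a‖).sum :=
          add_le_add (mul_le_mul_of_nonneg_left hP (norm_nonneg _)) (mul_le_mul (hg a (by simp)) ih (norm_nonneg _) zero_le_one)
      _ = ‖f a - g a‖ + (γ.map fun a => ‖f a - g a‖).sum := by ring

omit [NormOneClass R] in
/-- The sum of termwise distances is at most `|Γ|·ε`. [folklore] -/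
theorem sum_map_norm_sub_le (f g : α → R) {ε : ℝ} :
    ∀ (γ : List α), (∀ a ∈ γ, ‖f a - g a‖ ≤ ε) → (γ.map fun a => ‖f a - g a‖).sum ≤ γ.length * ε
  | [], _ => by simp
  | a :: γ, h => by
    rw [List.map_cons, List.sum_cons, List.length_cons]
    have ih := sum_map_norm_sub_le f g γ fun b hb => h b (List.mem_cons_of_mem a hb)
    have := h a (by simp)
    push_cast
    linarith

/-- ★ **THE FIRST-ORDER REMAINDER IS `|Γ|²δ`-LIPSCHITZ**: for factors of norm `≤ 1`, within `δ` of `1`, termwise within `ε`,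
`‖(Πf − 1 − Σ(f − 1)) − (Πg − 1 − Σ(g − 1))‖ ≤ |Γ|²·δ·ε` — from the recursion `Rem(f·Γ) = Rem(Γ) + (f − 1)(ΠΓ − 1)`, each step costing `2|Γ|δε`.
[cite: Balaban1985Averaging, Prop. 3 (122)-(123) p.36] -/
theorem norm_prodRem_sub_prodRem_le (f g : α → R) {δ ε : ℝ} (hδ : 0 ≤ δ) (hε : 0 ≤ ε) :
    ∀ (γ : List α), (∀ a ∈ γ, ‖f a‖ ≤ 1) → (∀ a ∈ γ, ‖g a‖ ≤ 1) → (∀ a ∈ γ, ‖f a - 1‖ ≤ δ) → (∀ a ∈ γ, ‖g a - 1‖ ≤ δ) →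
      (∀ a ∈ γ, ‖f a - g a‖ ≤ ε) →
      ‖((γ.map f).prod - 1 - (γ.map fun a => f a - 1).sum) - ((γ.map g).prod - 1 - (γ.map fun a => g a - 1).sum)‖ ≤ (γ.length : ℝ) ^ 2 * δ * ε
  | [], _, _, _, _, _ => by simp
  | a :: γ, hf1, hg1, hf, hg, hfg => by
    have hf1' : ∀ b ∈ γ, ‖f b‖ ≤ 1 := fun b hb => hf1 b (List.mem_cons_of_mem a hb)
    have hg1' : ∀ b ∈ γ, ‖g b‖ ≤ 1 := fun b hb => hg1 b (List.mem_cons_of_mem a hb)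
    have hf' : ∀ b ∈ γ, ‖f b - 1‖ ≤ δ := fun b hb => hf b (List.mem_cons_of_mem a hb)
    have hg' : ∀ b ∈ γ, ‖g b - 1‖ ≤ δ := fun b hb => hg b (List.mem_cons_of_mem a hb)
    have hfg' : ∀ b ∈ γ, ‖f b - g b‖ ≤ ε := fun b hb => hfg b (List.mem_cons_of_mem a hb)
    have ih := norm_prodRem_sub_prodRem_le f g hδ hε γ hf1' hg1' hf' hg' hfg'
    have hPf := norm_prod_map_sub_one_le f γ hf1' hf'
    have hPfg := (norm_prod_map_sub_prod_map_le f g γ hf1' hg1').trans (sum_map_norm_sub_le f g γ hfg')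
    simp only [List.map_cons, List.prod_cons, List.sum_cons, List.length_cons]
    set Pf := (γ.map f).prod
    set Pg := (γ.map g).prod
    set Sf := (γ.map fun a => f a - 1).sum
    set Sg := (γ.map fun a => g a - 1).sum
    have e : (f a * Pf - 1 - (f a - 1 + Sf)) - (g a * Pg - 1 - (g a - 1 + Sg)) =
        ((Pf - 1 - Sf) - (Pg - 1 - Sg)) + ((f a - g a) * (Pf - 1) + (g a - 1) * (Pf - Pg)) := by noncomm_ring
    rw [e]
    have hm : (0 : ℝ) ≤ γ.length := Nat.cast_nonneg _
    calc ‖((Pf - 1 - Sf) - (Pg - 1 - Sg)) + ((f a - g a) * (Pf - 1) + (g a - 1) * (Pf - Pg))‖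
        ≤ ‖(Pf - 1 - Sf) - (Pg - 1 - Sg)‖ + (‖f a - g a‖ * ‖Pf - 1‖ + ‖g a - 1‖ * ‖Pf - Pg‖) :=
          (norm_add_le _ _).trans (add_le_add le_rfl ((norm_add_le _ _).trans (add_le_add (norm_mul_le _ _) (norm_mul_le _ _))))
      _ ≤ (γ.length : ℝ) ^ 2 * δ * ε + (ε * (γ.length * δ) + δ * (γ.length * ε)) :=
          add_le_add ih (add_le_add (mul_le_mul (hfg a (by simp)) hPf (norm_nonneg _) hε) (mul_le_mul (hg a (by simp)) hPfg (norm_nonneg _) hδ))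
      _ ≤ ((γ.length + 1 : ℕ) : ℝ) ^ 2 * δ * ε := by
          push_cast
          nlinarith [mul_nonneg hδ hε, mul_nonneg hm (mul_nonneg hδ hε)]

end Products

/-! ## §2 `SU(N)` holonomies and their first-order remainders: Lipschitz in the configuration -/

section Hol

open scoped Matrix.Norms.L2Operator

variable {n : Type*} [Fintype n] [DecidableEq n] [Nonempty n] {P : Params} {j : ℕ}

omit [Nonempty n] in
/-- Elements of `SU(N)` are unitary matrices. [folklore] -/
private theorem coe_mem_unitaryGroup (g : Matrix.specialUnitaryGroup n ℂ) : (g : Matrix n n ℂ) ∈ Matrix.unitaryGroup n ℂ :=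
  (Matrix.mem_specialUnitaryGroup_iff.1 g.2).1

/-- `‖g‖ = 1` (`L²`-operator norm) for `g ∈ SU(N)`. [folklore] -/
private theorem norm_coe_su_eq_one (g : Matrix.specialUnitaryGroup n ℂ) : ‖(g : Matrix n n ℂ)‖ = 1 :=
  CStarRing.norm_of_mem_unitary (coe_mem_unitaryGroup g)

omit [Nonempty n] in
/-- `g* · g = 1` for `g ∈ SU(N)`. [folklore] -/
private theorem coe_star_mul_self (g : Matrix.specialUnitaryGroup n ℂ) : star (g : Matrix n n ℂ) * (g : Matrix n n ℂ) = 1 :=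
  Unitary.star_mul_self_of_mem (coe_mem_unitaryGroup g)

/-- The step factors (`U_b` forward, `U_b*` backward) have norm `1` (public twin: `UnitScaleTiltProp7HolRatioPerStep.norm_stepFactor'`; kept private here). [folklore] -/
private theorem norm_stepFactor_eq_one (U : GaugeField P j (Matrix.specialUnitaryGroup n ℂ)) (s : LStep P j) : ‖stepFactor U s‖ = 1 := by
  unfold stepFactor
  split_ifs
  · exact norm_coe_su_eq_one _
  · rw [norm_star]; exact norm_coe_su_eq_one _

omit [Nonempty n] in
/-- The step factors of two configurations differ by exactly the bond variables' distance (`‖A*‖ = ‖A‖`). [folklore] -/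
theorem norm_stepFactor_sub_stepFactor_eq (U U' : GaugeField P j (Matrix.specialUnitaryGroup n ℂ)) (s : LStep P j) :
    ‖stepFactor U s - stepFactor U' s‖ =
      ‖((U s.bond : Matrix.specialUnitaryGroup n ℂ) : Matrix n n ℂ) - ((U' s.bond : Matrix.specialUnitaryGroup n ℂ) : Matrix n n ℂ)‖ := by
  unfold stepFactor
  split_ifs
  · rfl
  · rw [← star_sub, norm_star]

omit [Nonempty n] in
/-- A step factor is within `δ` of `1` when its bond variable is (`U_b* − 1 = (U_b − 1)*`). [folklore] -/
theorem norm_stepFactor_sub_one_le (U : GaugeField P j (Matrix.specialUnitaryGroup n ℂ)) {δ : ℝ} (s : LStep P j)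
    (hU : ‖((U s.bond : Matrix.specialUnitaryGroup n ℂ) : Matrix n n ℂ) - 1‖ ≤ δ) : ‖stepFactor U s - 1‖ ≤ δ := by
  unfold stepFactor
  split_ifs
  · exact hU
  · rw [← star_one (R := Matrix n n ℂ), ← star_sub, norm_star]; exact hU

/-- ★ **HOLONOMIES ARE `1`-LIPSCHITZ IN EACH BOND VARIABLE**: `‖U(Γ) − U′(Γ)‖ ≤ Σ_{s ∈ Γ} ‖U_{b(s)} − U′_{b(s)}‖` (unitary factors, §1).
[cite: Balaban1985Averaging, Prop. 3 p.36 («an analytic function of A»)] -/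
theorem norm_holAt_sub_holAt_le (U U' : GaugeField P j (Matrix.specialUnitaryGroup n ℂ)) (γ : List (LStep P j)) :
    ‖((holAt U γ : Matrix.specialUnitaryGroup n ℂ) : Matrix n n ℂ) - ((holAt U' γ : Matrix.specialUnitaryGroup n ℂ) : Matrix n n ℂ)‖ ≤
      (γ.map fun s => ‖((U s.bond : Matrix.specialUnitaryGroup n ℂ) : Matrix n n ℂ) - ((U' s.bond : Matrix.specialUnitaryGroup n ℂ) : Matrix n n ℂ)‖).sum := by
  rw [coe_holAt_eq_prod_stepFactor, coe_holAt_eq_prod_stepFactor]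
  have h := norm_prod_map_sub_prod_map_le (stepFactor U) (stepFactor U') γ (fun s _ => (norm_stepFactor_eq_one U s).le)
    fun s _ => (norm_stepFactor_eq_one U' s).le
  have e : (γ.map fun s => ‖stepFactor U s - stepFactor U' s‖) =
      γ.map fun s => ‖((U s.bond : Matrix.specialUnitaryGroup n ℂ) : Matrix n n ℂ) - ((U' s.bond : Matrix.specialUnitaryGroup n ℂ) : Matrix n n ℂ)‖ :=
    List.map_congr_left fun s _ => norm_stepFactor_sub_stepFactor_eq U U' s
  rw [e] at h
  exact h

omit [Nonempty n] in
/-- The backward-step second-order term: `U* − 1 + (U − 1) = U*(U − 1)²` for unitary `U`. [folklore] -/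
private theorem star_sub_one_add_eq (g : Matrix.specialUnitaryGroup n ℂ) :
    star (g : Matrix n n ℂ) - 1 + ((g : Matrix n n ℂ) - 1) = star (g : Matrix n n ℂ) * (((g : Matrix n n ℂ) - 1) * ((g : Matrix n n ℂ) - 1)) := by
  have h := coe_star_mul_self g
  have e1 : star (g : Matrix n n ℂ) * (((g : Matrix n n ℂ) - 1) * ((g : Matrix n n ℂ) - 1)) =
      star (g : Matrix n n ℂ) * (g : Matrix n n ℂ) * (g : Matrix n n ℂ) - star (g : Matrix n n ℂ) * (g : Matrix n n ℂ) -
        star (g : Matrix n n ℂ) * (g : Matrix n n ℂ) + star (g : Matrix n n ℂ) := by noncomm_ring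
  rw [e1, h]; noncomm_ring

/-- **The backward-step second-order term is `3δ`-Lipschitz**: for `g, g′ ∈ SU(N)` within `δ ≤ 1` of `1` and within `ε` of each other,
`‖(g* − 1 + (g − 1)) − (g′* − 1 + (g′ − 1))‖ ≤ 3δε`. [cite: Balaban1985Averaging, Prop. 3 (122)-(123) p.36] -/
theorem norm_starRem_sub_starRem_le (g g' : Matrix.specialUnitaryGroup n ℂ) {δ ε : ℝ} (hg : ‖(g : Matrix n n ℂ) - 1‖ ≤ δ)
    (hg' : ‖(g' : Matrix n n ℂ) - 1‖ ≤ δ) (hgg' : ‖(g : Matrix n n ℂ) - (g' : Matrix n n ℂ)‖ ≤ ε) (hδ : 0 ≤ δ) (hδ1 : δ ≤ 1) (hε : 0 ≤ ε) :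
    ‖(star (g : Matrix n n ℂ) - 1 + ((g : Matrix n n ℂ) - 1)) - (star (g' : Matrix n n ℂ) - 1 + ((g' : Matrix n n ℂ) - 1))‖ ≤ 3 * δ * ε := by
  rw [star_sub_one_add_eq, star_sub_one_add_eq]
  set a : Matrix n n ℂ := (g : Matrix n n ℂ) - 1
  set a' : Matrix n n ℂ := (g' : Matrix n n ℂ) - 1
  have hd : (g : Matrix n n ℂ) - (g' : Matrix n n ℂ) = a - a' := by simp [a, a']
  have e : star (g : Matrix n n ℂ) * (a * a) - star (g' : Matrix n n ℂ) * (a' * a') =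
      (star (g : Matrix n n ℂ) - star (g' : Matrix n n ℂ)) * (a * a) + star (g' : Matrix n n ℂ) * (a * (a - a') + (a - a') * a') := by noncomm_ring
  rw [e]
  have hstar : ‖star (g : Matrix n n ℂ) - star (g' : Matrix n n ℂ)‖ ≤ ε := by rw [← star_sub, norm_star, hd]; rwa [hd] at hgg'
  have hg'1 : ‖star (g' : Matrix n n ℂ)‖ = 1 := by rw [norm_star]; exact norm_coe_su_eq_one g'
  have haa' : ‖a - a'‖ ≤ ε := by rw [← hd]; exact hgg'
  calc ‖(star (g : Matrix n n ℂ) - star (g' : Matrix n n ℂ)) * (a * a) + star (g' : Matrix n n ℂ) * (a * (a - a') + (a - a') * a')‖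
      ≤ ‖star (g : Matrix n n ℂ) - star (g' : Matrix n n ℂ)‖ * (‖a‖ * ‖a‖) + ‖star (g' : Matrix n n ℂ)‖ * (‖a‖ * ‖a - a'‖ + ‖a - a'‖ * ‖a'‖) := by
        refine (norm_add_le _ _).trans (add_le_add ((norm_mul_le _ _).trans (mul_le_mul_of_nonneg_left (norm_mul_le _ _) (norm_nonneg _)))
          ((norm_mul_le _ _).trans (mul_le_mul_of_nonneg_left ((norm_add_le _ _).trans (add_le_add (norm_mul_le _ _) (norm_mul_le _ _))) (norm_nonneg _))))
    _ ≤ ε * (δ * δ) + 1 * (δ * ε + ε * δ) := by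
        rw [hg'1]
        gcongr
    _ ≤ 3 * δ * ε := by nlinarith [mul_nonneg hδ hε, mul_nonneg (mul_nonneg hδ hδ) hε]

/-- The per-step second-order term `(f_s − 1) − (±Y_{b(s)})` (`0` forward, `U* − 1 + (U − 1)` backward) is `3δ`-Lipschitz in the bond variable.
[cite: Balaban1985Averaging, Prop. 3 (122)-(123) p.36] -/
theorem norm_signedRem_sub_signedRem_le (U U' : GaugeField P j (Matrix.specialUnitaryGroup n ℂ)) {δ ε : ℝ} (hδ : 0 ≤ δ) (hδ1 : δ ≤ 1)
    (hε : 0 ≤ ε) (s : LStep P j) (hUs : ‖((U s.bond : Matrix.specialUnitaryGroup n ℂ) : Matrix n n ℂ) - 1‖ ≤ δ)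
    (hU's : ‖((U' s.bond : Matrix.specialUnitaryGroup n ℂ) : Matrix n n ℂ) - 1‖ ≤ δ)
    (hs : ‖((U s.bond : Matrix.specialUnitaryGroup n ℂ) : Matrix n n ℂ) - ((U' s.bond : Matrix.specialUnitaryGroup n ℂ) : Matrix n n ℂ)‖ ≤ ε) :
    ‖((stepFactor U s - 1) - (if s.fwd then ((U s.bond : Matrix.specialUnitaryGroup n ℂ) : Matrix n n ℂ) - 1
        else -(((U s.bond : Matrix.specialUnitaryGroup n ℂ) : Matrix n n ℂ) - 1))) -
      ((stepFactor U' s - 1) - (if s.fwd then ((U' s.bond : Matrix.specialUnitaryGroup n ℂ) : Matrix n n ℂ) - 1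
        else -(((U' s.bond : Matrix.specialUnitaryGroup n ℂ) : Matrix n n ℂ) - 1)))‖ ≤ 3 * δ * ε := by
  unfold stepFactor
  cases s.fwd
  · simp only [Bool.false_eq_true, ↓reduceIte, sub_neg_eq_add]
    exact norm_starRem_sub_starRem_le _ _ hUs hU's hs hδ hδ1 hε
  · simp only [↓reduceIte, sub_self, norm_zero]
    positivity

/-- The sum of the per-step second-order terms along `Γ` is `3|Γ|δ`-Lipschitz. [cite: Balaban1985Averaging, Prop. 3 (122)-(123) p.36] -/
theorem norm_sumRem_sub_sumRem_le (U U' : GaugeField P j (Matrix.specialUnitaryGroup n ℂ)) {δ ε : ℝ} (hδ : 0 ≤ δ) (hδ1 : δ ≤ 1) (hε : 0 ≤ ε) :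
    ∀ γ : List (LStep P j), (∀ s ∈ γ, ‖((U s.bond : Matrix.specialUnitaryGroup n ℂ) : Matrix n n ℂ) - 1‖ ≤ δ) →
      (∀ s ∈ γ, ‖((U' s.bond : Matrix.specialUnitaryGroup n ℂ) : Matrix n n ℂ) - 1‖ ≤ δ) →
      (∀ s ∈ γ, ‖((U s.bond : Matrix.specialUnitaryGroup n ℂ) : Matrix n n ℂ) -
        ((U' s.bond : Matrix.specialUnitaryGroup n ℂ) : Matrix n n ℂ)‖ ≤ ε) →
      ‖((γ.map fun s => stepFactor U s - 1).sum - walkSum (fun b => ((U b : Matrix.specialUnitaryGroup n ℂ) : Matrix n n ℂ) - 1) γ) -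
          ((γ.map fun s => stepFactor U' s - 1).sum - walkSum (fun b => ((U' b : Matrix.specialUnitaryGroup n ℂ) : Matrix n n ℂ) - 1) γ)‖ ≤
        γ.length * (3 * δ * ε)
  | [], _, _, _ => by simp [walkSum]
  | s :: γ, hU, hU', h => by
    have ih := norm_sumRem_sub_sumRem_le U U' hδ hδ1 hε γ (fun t ht => hU t (List.mem_cons_of_mem s ht))
      (fun t ht => hU' t (List.mem_cons_of_mem s ht)) fun t ht => h t (List.mem_cons_of_mem s ht)
    have hs := norm_signedRem_sub_signedRem_le U U' hδ hδ1 hε s (hU s (by simp)) (hU' s (by simp)) (h s (by simp))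
    rw [List.map_cons, List.map_cons, List.sum_cons, List.sum_cons, walkSum_cons, walkSum_cons, List.length_cons]
    set A := stepFactor U s - 1
    set A' := stepFactor U' s - 1
    set σ := (if s.fwd then ((U s.bond : Matrix.specialUnitaryGroup n ℂ) : Matrix n n ℂ) - 1 else -(((U s.bond : Matrix.specialUnitaryGroup n ℂ) : Matrix n n ℂ) - 1))
    set σ' := (if s.fwd then ((U' s.bond : Matrix.specialUnitaryGroup n ℂ) : Matrix n n ℂ) - 1 else -(((U' s.bond : Matrix.specialUnitaryGroup n ℂ) : Matrix n n ℂ) - 1))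
    set T := (γ.map fun s => stepFactor U s - 1).sum
    set T' := (γ.map fun s => stepFactor U' s - 1).sum
    set W := walkSum (fun b => ((U b : Matrix.specialUnitaryGroup n ℂ) : Matrix n n ℂ) - 1) γ
    set W' := walkSum (fun b => ((U' b : Matrix.specialUnitaryGroup n ℂ) : Matrix n n ℂ) - 1) γ
    have e : (A + T - (σ + W)) - (A' + T' - (σ' + W')) = ((A - σ) - (A' - σ')) + ((T - W) - (T' - W')) := by abel
    rw [e]
    calc ‖((A - σ) - (A' - σ')) + ((T - W) - (T' - W'))‖ ≤ ‖(A - σ) - (A' - σ')‖ + ‖(T - W) - (T' - W')‖ := norm_add_le _ _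
      _ ≤ 3 * δ * ε + γ.length * (3 * δ * ε) := add_le_add hs ih
      _ = ((γ.length + 1 : ℕ) : ℝ) * (3 * δ * ε) := by push_cast; ring

/-- ★ **THE FIRST-ORDER REMAINDER OF AN `SU(N)` HOLONOMY IS LIPSCHITZ IN THE CONFIGURATION**: for two configurations with all bond variables within `δ ≤ 1`
of `1` and within `ε` of each other ON THE BONDS OF `Γ` (walk-local hypotheses),
`‖(U(Γ) − 1 − Y(Γ)) − (U′(Γ) − 1 − Y′(Γ))‖ ≤ (|Γ|² + 3|Γ|)·δ·ε` (`Y = U − 1`; §1's product remainder plus the backward-step terms).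
[cite: Balaban1985Averaging, Prop. 3 (122)-(123) p.36] -/
theorem norm_holAtRem_sub_holAtRem_le (U U' : GaugeField P j (Matrix.specialUnitaryGroup n ℂ)) {δ ε : ℝ} (hδ : 0 ≤ δ) (hδ1 : δ ≤ 1)
    (hε : 0 ≤ ε) (γ : List (LStep P j)) (hU : ∀ s ∈ γ, ‖((U s.bond : Matrix.specialUnitaryGroup n ℂ) : Matrix n n ℂ) - 1‖ ≤ δ)
    (hU' : ∀ s ∈ γ, ‖((U' s.bond : Matrix.specialUnitaryGroup n ℂ) : Matrix n n ℂ) - 1‖ ≤ δ)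
    (hγ : ∀ s ∈ γ, ‖((U s.bond : Matrix.specialUnitaryGroup n ℂ) : Matrix n n ℂ) -
        ((U' s.bond : Matrix.specialUnitaryGroup n ℂ) : Matrix n n ℂ)‖ ≤ ε) :
    ‖(((holAt U γ : Matrix.specialUnitaryGroup n ℂ) : Matrix n n ℂ) - 1 - walkSum (fun b => ((U b : Matrix.specialUnitaryGroup n ℂ) : Matrix n n ℂ) - 1) γ) -
        (((holAt U' γ : Matrix.specialUnitaryGroup n ℂ) : Matrix n n ℂ) - 1 -
          walkSum (fun b => ((U' b : Matrix.specialUnitaryGroup n ℂ) : Matrix n n ℂ) - 1) γ)‖ ≤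
      ((γ.length : ℝ) ^ 2 + 3 * γ.length) * δ * ε := by
  rw [coe_holAt_eq_prod_stepFactor, coe_holAt_eq_prod_stepFactor]
  have hprod := norm_prodRem_sub_prodRem_le (stepFactor U) (stepFactor U') hδ hε γ (fun s _ => (norm_stepFactor_eq_one U s).le)
    (fun s _ => (norm_stepFactor_eq_one U' s).le) (fun s hs => norm_stepFactor_sub_one_le U s (hU s hs))
    (fun s hs => norm_stepFactor_sub_one_le U' s (hU' s hs)) (fun s hs => by rw [norm_stepFactor_sub_stepFactor_eq]; exact hγ s hs)
  have hsum := norm_sumRem_sub_sumRem_le U U' hδ hδ1 hε γ hU hU' hγ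
  set Pf := (γ.map (stepFactor U)).prod
  set Pg := (γ.map (stepFactor U')).prod
  set Sf := (γ.map fun s => stepFactor U s - 1).sum
  set Sg := (γ.map fun s => stepFactor U' s - 1).sum
  set W := walkSum (fun b => ((U b : Matrix.specialUnitaryGroup n ℂ) : Matrix n n ℂ) - 1) γ
  set W' := walkSum (fun b => ((U' b : Matrix.specialUnitaryGroup n ℂ) : Matrix n n ℂ) - 1) γ
  have e : (Pf - 1 - W) - (Pg - 1 - W') = ((Pf - 1 - Sf) - (Pg - 1 - Sg)) + ((Sf - W) - (Sg - W')) := by abel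
  rw [e]
  have hm : (0 : ℝ) ≤ γ.length := Nat.cast_nonneg _
  calc ‖((Pf - 1 - Sf) - (Pg - 1 - Sg)) + ((Sf - W) - (Sg - W'))‖ ≤ ‖(Pf - 1 - Sf) - (Pg - 1 - Sg)‖ + ‖(Sf - W) - (Sg - W')‖ := norm_add_le _ _
    _ ≤ (γ.length : ℝ) ^ 2 * δ * ε + γ.length * (3 * δ * ε) := add_le_add hprod hsum
    _ = ((γ.length : ℝ) ^ 2 + 3 * γ.length) * δ * ε := by ring

end Hol

end YMDAG.N18.HolonomyLipschitz
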